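import Literature.MathematicalPhysics.QuantumFieldTheory.Balaban1983to89.B11Rem289KernelColumnsTheta3
import Literature.MathematicalPhysics.QuantumFieldTheory.Balaban1983to89.B11Eq88KernelColumnsComposite
import Summits.QuantumFields.YangMills.Theorems.UnitScaleTiltProp7SectET3Transport
import HarnessLib

/-!
# Route `UnitScaleTilt`, crux K1 «MinimiserStabilityRegPr» (stmt-QuantumFields-19200), stub EX `stub_existenceMinimalOrbit`, (W-X′) residue «THETA-OF-W6» —
# THE `Pi`-LANGUAGE FRONT END OF THE THREE KERNEL-COLUMN CARRIERS ([Balaban1985Variational] (73), (86)–(88), Remark p.289): for `H = H₀ ∘L piIsoNegSize0` (the shape of the letter of record ✓`H1f`) and `C : Space115 → (β → 𝔸)`,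
# the rows `hΘE hΘ′ hΘ3` of lit ✓`B11Eq98W80Composite.quadAnalytic_W80_composite` follow from the one-block letter of `H`, the one-bond coarse-column letter of `C′`,
# the one-block letter of `N ∘ H`, the Sect. C regime of `(H, C)` and the Neumann window — all stated on PLAIN `Pi` block fields (no `NegSup` in the hypotheses)

Cell `ym3-torus`, width seat `ym3-torus-px6` (gen 4); LOCATE «THETA-OF-W6» (HOME `ym3-torus-px6/g4/LOCATE-THETA-OF-W6-px6g4.md`, 46e408e5f8be67a4) §3–§4, EX namer ★ym-ust-19200-w2 g7
WORDS (13)∕(16) 2026-08-29.  THEOREMS ONLY (0 `def`, 0 `sorry`); `--supports stmt-QuantumFields-19200 --as helper`, count-neutral.  YM₃ on T³ is a ladder rung (R3), not the Clay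
problem; nothing here claims EX, the stub, the crux, d = 4 or the mass gap.

WHY.  The PROP4-W80 door of the EX display (S14∕S15, engine ✓`B11Eq98W80Composite.quadAnalytic_W80_composite`) displays the three KERNEL-COLUMN rows `hΘE hΘ′ hΘ3` at the
(W-X′) letters `H̃ᴾ := H1f … (DeltaPiSlotP …) U₀ : (PBond (F.P n) 0 → M₂(ℂ)) →L[ℂ] Space115 …` and `C̃ : Space115 … → (PBond (F.P n) 0 → M₂(ℂ))` — PLAIN `Pi` block fields.
The three lit carriers that close these rows (✓`B11Eq73KernelColumnsCarrier.colSum_weighted_kernel_fderiv_Emap_le`, ✓`B11Eq88KernelColumnsComposite.colSum_weighted_comp_fderiv_Emap_le`,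
✓`B11Rem289KernelColumnsTheta3.colSum_weighted_kernel_fderiv_E3_le`) are typed over the weighted coarse carrier `NegSup wB 𝔸`.  Since ✓`H1f` IS `(H1CLM … (HT …)).comp piIsoNegSize0`
by definition, the seam is the identity-underlying isometry `piIsoNegSize0 : (β → 𝔸) ≃ₗᵢ NegSize L η levB 0 𝔸` (✓`Prop7SectET3Transport`): this file proves that `Emap`∕`E3` (print's
`HD`, `HD₃`) are invariant under moving the bridge from `H` to `C` (§1), that the Sect. C regime and Prop. 4's hypothesis move with it (§2), and restates the three carriers with
every letter on `Pi` block fields (§3) — so the T³ door «THETA-OF-W6» is an instantiation with weights `1` and the volume factors `L^{±3(K−n)}` displayed.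

WHAT IS PROVED (ns `…Theorems.Prop7ThetaOfColumnLettersPi`; generic fibre `𝔸`, fine bonds `Bond d Pd`, block index `β`, `H₀ : NegSize L η levB 0 𝔸 →L Space115`, `C : Space115 → (β → 𝔸)`).
* §1 `bridgeCLM_apply`, `equiv_bridge_apply`, `bridge_single`, `mapT_comp_piIso`, ★`Emap_comp_piIso` (`Emap (H₀ ∘L bridge) C = Emap H₀ (bridge ∘ C)` — NOT `rfl` for the
  elaborator (`isDefEq` times out); `funext` + `unfold Emap solA` + the `mapT` identity), `piIso_quadPart` (Mathlib `ContinuousLinearEquiv.iteratedFDeriv_comp_left`),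
  ★`E3_comp_piIso`, `equiv_fderiv_bridge_comp` (Mathlib `ContinuousLinearEquiv.comp_fderiv`, no differentiability hypothesis).
* §2 `regime_comp_piIso` (`Regime (H₀ ∘L bridge) 0 C … → Regime H₀ 0 (bridge ∘ C) …`), `prop4Hyp_comp_piIso`.
* §3 `hHk_carrier`, `hCg_carrier`, `hNk_carrier` (the `Pi`-language letters ARE the carriers' letters) and the three rows ★★★`thetaE_row` (`θE = 2Θ_H^wGℓ`), ★★★`thetaPrime_row`
  (`θE′ = 2Θ′Gℓ`, any fine weight `r ≥ 0`), ★★★`theta3_row` (`θ₃ = (2ℓ+1)Θ_H^wG∕a_C`, `[CompleteSpace 𝔸]`), `ℓ = (1 − 4bC₂(ε_C + a_C))⁻¹` — hypotheses: `RC : Regime (H₀ ∘L bridge) 0 C …`,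
  `hC : Prop4Hyp C C₂ c₄`, the one-block letter of `H₀ ∘L bridge` on `Pi.single y Z` with fine column sums `Θ_H` (plain) ∕ `Θ_H^w` (weighted), the one-bond coarse-column letter of
  `C′` read componentwise on `Pi` with `Σ_y gC y bb ≤ G`, the Neumann window `(ε_C + a_C)Θ_HG ≤ ½`, and for `hΘ′` the one-block letter of `N ∘ (H₀ ∘L bridge)`.
HONEST SCOPE.  Typing∕transport only — every estimate is the lit carriers'; the letters (print's (3.133), (88), (157)) stay hypotheses; nothing instantiated at T³ here; the
constants are crude (no decay used).  Nothing of EX, the stub or the crux is claimed.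

References: T. Bałaban, CMP 102 (1985) 277–309 [Balaban1985Variational] ((47)–(49) p.285, (56)–(57) p.286, (63) p.287, (68)–(73) pp.288–289, (78) p.290, (85)–(88) p.291, Prop. 4
(97)–(98) pp.292–293, (116) p.295, (175) p.305); CMP 99 (1985) 389–434 [Balaban1985BackgroundPropagators] ((3.132)–(3.133) p.423); CMP 98 (1985) 17–51 [Balaban1985Averaging] ((157) p.42).
-/

set_option autoImplicit false

noncomputable section

open scoped BigOperators
open Finset Metric Set

namespace Summit.QuantumFields.YangMills.Theorems.Prop7ThetaOfColumnLettersPi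

open Literature.MathematicalPhysics.QuantumFieldTheory.Balaban1983to89
open B9SectCLatticeCarrier (Bond)
open B11Eq115Space (NegSize Space115 JetSup NegSup levWeight)
open B11Eq80Current (Emap E3 quadPart)
open B11Eq174Chart (solA Regime)
open B11Prop6Scheme (mapT mapT_apply Prop4Hyp)
open B13Contraction113 (QuadAnalytic)
open B11Eq90Transpose (kernel single115)
open B11Eq90V0primeCurrent (flat115)
open B11Eq73KernelColumnsCarrier (colSum_weighted_kernel_fderiv_Emap_le)
open B11Rem289KernelColumnsTheta3 (colSum_weighted_kernel_fderiv_E3_le)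
open B11Eq88KernelColumnsComposite (colSum_weighted_comp_fderiv_Emap_le)
open Summit.QuantumFields.YangMills.Theorems.Prop7SectET3Transport (piIsoNegSize0)

variable {𝔸 : Type*} [NormedRing 𝔸] [NormedAlgebra ℂ 𝔸]
variable {d : ℕ} {Pd : Fin d → ℕ} {L η : ℝ} [Fact (0 < L)] [Fact (0 < η)] {lev₀ : Bond d Pd → ℕ} {κ' : Type*} [Fintype κ']
  {lev₁ : κ' → ℕ} {Dc : (Bond d Pd → 𝔸) →ₗ[ℂ] (κ' → 𝔸)}
variable {β : Type*} [Fintype β] (levB : β → ℕ)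

/-! ## §1 The bridge `piIsoNegSize0` passes through `Emap`, `quadPart`, `E3` -/

section Bridge

/-- The bridge read as a `→L[ℂ]` acts as the bridge. [folklore] -/
theorem bridgeCLM_apply (f : β → 𝔸) :
    (piIsoNegSize0 𝔸 L η levB).toLinearIsometry.toContinuousLinearMap f = piIsoNegSize0 𝔸 L η levB f := rfl

/-- The bridge is the identity on underlying functions. [folklore] -/
theorem equiv_bridge_apply (f : β → 𝔸) (y : β) : NegSup.equiv (levWeight L η levB 0) 𝔸 (piIsoNegSize0 𝔸 L η levB f) y = f y := rfl

/-- … and `(NegSup.equiv).symm (Pi.single y Z)` IS the bridge of `Pi.single y Z`. [folklore] -/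
theorem bridge_single [DecidableEq β] (y : β) (Z : 𝔸) :
    (NegSup.equiv (levWeight L η levB 0) 𝔸).symm (Pi.single y Z) = piIsoNegSize0 𝔸 L η levB (Pi.single y Z) := rfl

/-- The Prop-6 maps `mapT` of `(H₀ ∘L bridge, C)` and `(H₀, bridge ∘ C)` coincide. [cite: Balaban1985Variational, (116) p.295, (175) p.305] -/
theorem mapT_comp_piIso (H₀ : NegSize L η levB 0 𝔸 →L[ℂ] Space115 L η lev₀ lev₁ Dc) (C : Space115 L η lev₀ lev₁ Dc → (β → 𝔸))
    (A' : Space115 L η lev₀ lev₁ Dc) :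
    mapT (H₀.comp (piIsoNegSize0 𝔸 L η levB).toLinearIsometry.toContinuousLinearMap) 0 C 0 A'
      = mapT H₀ 0 ((piIsoNegSize0 𝔸 L η levB) ∘ C) 0 A' := by
  funext X
  rw [mapT_apply, mapT_apply, map_zero, map_zero, ContinuousLinearMap.comp_apply, bridgeCLM_apply, Function.comp_apply]

/-- ★ **`HD(A′)` IS BRIDGE-INVARIANT**: `Emap (H₀ ∘L bridge) C εC = Emap H₀ (bridge ∘ C) εC` (print's `HD = −solA`, a fixed point of `mapT`, which reads only the composite `H(C ·)`).
[cite: Balaban1985Variational, (47)–(49) p.285, (175) p.305] -/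
theorem Emap_comp_piIso (H₀ : NegSize L η levB 0 𝔸 →L[ℂ] Space115 L η lev₀ lev₁ Dc) (C : Space115 L η lev₀ lev₁ Dc → (β → 𝔸)) (εC : ℝ) :
    Emap (H₀.comp (piIsoNegSize0 𝔸 L η levB).toLinearIsometry.toContinuousLinearMap) C εC
      = Emap H₀ ((piIsoNegSize0 𝔸 L η levB) ∘ C) εC := by
  funext A'
  unfold Emap solA
  simp only [mapT_comp_piIso]

/-- The bridge passes through the second-order part: `bridge (C⁽²⁾(Y)) = (bridge ∘ C)⁽²⁾(Y)` (iterated derivatives commute with continuous linear equivalences).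
[cite: Balaban1985Variational, (56) p.286, (78) p.290] -/
theorem piIso_quadPart (C : Space115 L η lev₀ lev₁ Dc → (β → 𝔸)) (Y : Space115 L η lev₀ lev₁ Dc) :
    (piIsoNegSize0 𝔸 L η levB) (quadPart C Y) = quadPart ((piIsoNegSize0 𝔸 L η levB) ∘ C) Y := by
  unfold quadPart
  rw [map_smul]
  congr 1
  have h := (piIsoNegSize0 𝔸 L η levB).toContinuousLinearEquiv.iteratedFDeriv_comp_left (f := C) (x := (0 : Space115 L η lev₀ lev₁ Dc)) (i := 2)
  have hcoe : ((piIsoNegSize0 𝔸 L η levB).toContinuousLinearEquiv : (β → 𝔸) → NegSize L η levB 0 𝔸) ∘ C = (piIsoNegSize0 𝔸 L η levB) ∘ C := rfl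
  rw [hcoe] at h
  rw [h, ContinuousLinearMap.compContinuousMultilinearMap_coe, Function.comp_apply]
  rfl

/-- ★ **`HD₃(A′)` IS BRIDGE-INVARIANT**: `E3 (H₀ ∘L bridge) C εC = E3 H₀ (bridge ∘ C) εC`. [cite: Balaban1985Variational, (78) p.290] -/
theorem E3_comp_piIso (H₀ : NegSize L η levB 0 𝔸 →L[ℂ] Space115 L η lev₀ lev₁ Dc) (C : Space115 L η lev₀ lev₁ Dc → (β → 𝔸)) (εC : ℝ) :
    E3 (H₀.comp (piIsoNegSize0 𝔸 L η levB).toLinearIsometry.toContinuousLinearMap) C εC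
      = E3 H₀ ((piIsoNegSize0 𝔸 L η levB) ∘ C) εC := by
  funext A'
  unfold E3
  rw [Emap_comp_piIso, ContinuousLinearMap.comp_apply, bridgeCLM_apply, piIso_quadPart]

/-- `fderiv` of `bridge ∘ C` read back on `Pi`: `(D(bridge ∘ C)(A)δ)(y) = (DC(A)δ)(y)` (no differentiability hypothesis: the bridge is an equivalence).
[cite: Balaban1985Variational, (63) p.287] -/
theorem equiv_fderiv_bridge_comp (C : Space115 L η lev₀ lev₁ Dc → (β → 𝔸)) (A δ : Space115 L η lev₀ lev₁ Dc) (y : β) :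
    NegSup.equiv (levWeight L η levB 0) 𝔸 (fderiv ℂ ((piIsoNegSize0 𝔸 L η levB) ∘ C) A δ) y = fderiv ℂ C A δ y := by
  have h := (piIsoNegSize0 𝔸 L η levB).toContinuousLinearEquiv.comp_fderiv (f := C) (x := A)
  have hcoe : ((piIsoNegSize0 𝔸 L η levB).toContinuousLinearEquiv : (β → 𝔸) → NegSize L η levB 0 𝔸) ∘ C = (piIsoNegSize0 𝔸 L η levB) ∘ C := rfl
  rw [hcoe] at h
  rw [h, ContinuousLinearMap.comp_apply]
  rfl

end Bridge

/-! ## §2 The Sect. C regime and Prop. 4's hypothesis pass through the bridge -/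

section Transport

variable {H₀ : NegSize L η levB 0 𝔸 →L[ℂ] Space115 L η lev₀ lev₁ Dc} {C : Space115 L η lev₀ lev₁ Dc → (β → 𝔸)} {b C₂ c₄ aC εC : ℝ}

/-- The Sect. C regime of `(H₀ ∘L bridge, C)` is the Sect. C regime of `(H₀, bridge ∘ C)` (the bridge is norm-preserving). [cite: Balaban1985Variational, Prop. 3 pp.285–286, (175) p.305] -/
theorem regime_comp_piIso (RC : Regime (H₀.comp (piIsoNegSize0 𝔸 L η levB).toLinearIsometry.toContinuousLinearMap) 0 C b 0 C₂ c₄ 0 aC εC) :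
    Regime H₀ 0 ((piIsoNegSize0 𝔸 L η levB) ∘ C) b 0 C₂ c₄ 0 aC εC where
  norm_G f := by
    have h := RC.norm_G ((piIsoNegSize0 𝔸 L η levB).symm f)
    rw [ContinuousLinearMap.comp_apply, bridgeCLM_apply, LinearIsometryEquiv.apply_symm_apply, LinearIsometryEquiv.norm_map] at h
    exact h
  norm_L := RC.norm_L
  quad :=
    { quad := fun Y hY => by
        rw [Function.comp_apply, LinearIsometryEquiv.norm_map]
        exact RC.quad.quad Y hY
      lineAnalytic := fun P Q =>
        (piIsoNegSize0 𝔸 L η levB).toContinuousLinearEquiv.differentiable.comp_differentiableOn (RC.quad.lineAnalytic P Q) }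
  B₀_nonneg := RC.B₀_nonneg
  C₄_nonneg := RC.C₄_nonneg
  θ_nonneg := RC.θ_nonneg
  ε₄_nonneg := RC.ε₄_nonneg
  dom := RC.dom
  self := RC.self
  contr := RC.contr

/-- Prop. 4's hypothesis passes through the bridge. [cite: Balaban1985Variational, Prop. 4 (98) p.293] -/
theorem prop4Hyp_comp_piIso (hC : Prop4Hyp C C₂ c₄) : Prop4Hyp ((piIsoNegSize0 𝔸 L η levB) ∘ C) C₂ c₄ where
  quad Y hY := by
    rw [Function.comp_apply, LinearIsometryEquiv.norm_map]
    exact hC.quad Y hY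
  differentiableOn := (piIsoNegSize0 𝔸 L η levB).toContinuousLinearEquiv.differentiable.comp_differentiableOn hC.differentiableOn

end Transport

/-! ## §3 The three kernel-column rows from `Pi`-language letters -/

section Rows

variable [FiniteDimensional ℂ 𝔸] [DecidableEq β]
variable {H₀ : NegSize L η levB 0 𝔸 →L[ℂ] Space115 L η lev₀ lev₁ Dc} {C : Space115 L η lev₀ lev₁ Dc → (β → 𝔸)} {b C₂ c₄ aC εC : ℝ}
  (RC : Regime (H₀.comp (piIsoNegSize0 𝔸 L η levB).toLinearIsometry.toContinuousLinearMap) 0 C b 0 C₂ c₄ 0 aC εC) (hC : Prop4Hyp C C₂ c₄)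
  {hk : Bond d Pd → β → ℝ} (hk0 : ∀ b' y, 0 ≤ hk b' y)
  (hHk : ∀ (y : β) (Z : 𝔸) (b' : Bond d Pd),
    ‖flat115 ((H₀.comp (piIsoNegSize0 𝔸 L η levB).toLinearIsometry.toContinuousLinearMap) (Pi.single y Z)) b'‖ ≤ hk b' y * ‖Z‖)
  {ΘH : ℝ} (hΘH : 0 ≤ ΘH) (hH1 : ∀ y, ∑ b', hk b' y ≤ ΘH)
  {ΘHw : ℝ} (hΘHw : 0 ≤ ΘHw) (hHw : ∀ (bb : Bond d Pd) (y : β), ∑ b', levWeight L η lev₀ 3 bb / levWeight L η lev₀ 3 b' * hk b' y ≤ ΘHw)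
  {gC : β → Bond d Pd → ℝ} (hgC0 : ∀ y bb, 0 ≤ gC y bb)
  (hCg : ∀ A : Space115 L η lev₀ lev₁ Dc, ‖A‖ < εC + aC → ∀ (bb : Bond d Pd) (X : 𝔸) (y : β),
      ‖fderiv ℂ C A (single115 (lev₁ := lev₁) (Dc := Dc) bb X) y‖ ≤ gC y bb * ‖A‖ * ‖X‖)
  {G : ℝ} (hG : ∀ bb, ∑ y, gC y bb ≤ G) (hq : (εC + aC) * ΘH * G ≤ 1 / 2)

include hHk in
omit [FiniteDimensional ℂ 𝔸] in
/-- The one-block letter of `H₀ ∘L bridge` on `Pi.single` IS the carriers' one-block letter of `H₀`. [cite: Balaban1985Variational, (85) p.291] -/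
theorem hHk_carrier : ∀ (y : β) (Z : 𝔸) (b' : Bond d Pd),
    ‖flat115 (H₀ ((NegSup.equiv (levWeight L η levB 0) 𝔸).symm (Pi.single y Z))) b'‖ ≤ hk b' y * ‖Z‖ := by
  intro y Z b'
  have h := hHk y Z b'
  rw [ContinuousLinearMap.comp_apply, bridgeCLM_apply] at h
  exact h

include hCg in
omit [DecidableEq β] in
/-- The one-bond column letter of `C′` in `Pi` language IS the carriers' letter for `bridge ∘ C`. [cite: Balaban1985Variational, (73) p.289] -/
theorem hCg_carrier : ∀ A : Space115 L η lev₀ lev₁ Dc, ‖A‖ < εC + aC → ∀ (bb : Bond d Pd) (X : 𝔸) (y : β),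
    ‖NegSup.equiv (levWeight L η levB 0) 𝔸 (fderiv ℂ ((piIsoNegSize0 𝔸 L η levB) ∘ C) A (single115 (lev₁ := lev₁) (Dc := Dc) bb X)) y‖
      ≤ gC y bb * ‖A‖ * ‖X‖ := by
  intro A hA bb X y
  rw [equiv_fderiv_bridge_comp]
  exact hCg A hA bb X y

include RC hC hk0 hHk hΘH hH1 hΘHw hHw hgC0 hCg hG hq in
/-- ★★★ **ROW `hΘE` FROM `Pi`-LANGUAGE LETTERS** — on `‖A′‖ < a_C`, `Σ_{b′}(w₃(b)∕w₃(b′))‖k_{(HD)′(A′)}(b′, b)‖ ≤ 2Θ_H^wGℓ·‖A′‖`, `ℓ = (1 − 4bC₂(ε_C + a_C))⁻¹`, for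
`HD = Emap (H₀ ∘L bridge) C εC` (✓`B11Eq73KernelColumnsCarrier.colSum_weighted_kernel_fderiv_Emap_le` at `(H₀, bridge ∘ C)` + §1–§2).
[cite: Balaban1985Variational, (68)–(73) pp.288–289, (86) p.291] -/
theorem thetaE_row {A' : Space115 L η lev₀ lev₁ Dc} (hA' : ‖A'‖ < aC) (bb : Bond d Pd) :
    ∑ b', levWeight L η lev₀ 3 bb / levWeight L η lev₀ 3 b' *
        ‖kernel (fderiv ℂ (Emap (H₀.comp (piIsoNegSize0 𝔸 L η levB).toLinearIsometry.toContinuousLinearMap) C εC) A') b' bb‖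
      ≤ 2 * ΘHw * G * (1 / (1 - 4 * b * C₂ * (εC + aC))) * ‖A'‖ := by
  rw [Emap_comp_piIso]
  exact colSum_weighted_kernel_fderiv_Emap_le (regime_comp_piIso levB RC) (prop4Hyp_comp_piIso levB hC) hk0 (hHk_carrier levB hHk) hH1 hgC0
    (hCg_carrier levB hCg) hG hq hΘH hΘHw hHw hA' bb

variable {γ : Type*} [Fintype γ] {w' : γ → ℝ} [Fact (∀ i, 0 < w' i)]
  (N : Space115 L η lev₀ lev₁ Dc →L[ℂ] NegSup w' 𝔸)
  {hk' : γ → β → ℝ} (hk'0 : ∀ b' y, 0 ≤ hk' b' y)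
  (hNk : ∀ (y : β) (Z : 𝔸) (b' : γ),
    ‖NegSup.equiv w' 𝔸 (N ((H₀.comp (piIsoNegSize0 𝔸 L η levB).toLinearIsometry.toContinuousLinearMap) (Pi.single y Z))) b'‖ ≤ hk' b' y * ‖Z‖)

include hNk in
omit [FiniteDimensional ℂ 𝔸] in
/-- The one-block letter of `N ∘ (H₀ ∘L bridge)` on `Pi.single` IS the carriers' letter of `N ∘ H₀`. [cite: Balaban1985Variational, (88) p.291] -/
theorem hNk_carrier : ∀ (y : β) (Z : 𝔸) (b' : γ),
    ‖NegSup.equiv w' 𝔸 (N (H₀ ((NegSup.equiv (levWeight L η levB 0) 𝔸).symm (Pi.single y Z)))) b'‖ ≤ hk' b' y * ‖Z‖ := by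
  intro y Z b'
  have h := hNk y Z b'
  rw [ContinuousLinearMap.comp_apply, bridgeCLM_apply] at h
  exact h

include RC hC hk0 hHk hΘH hH1 hgC0 hCg hG hq hk'0 hNk in
/-- ★★★ **ROW `hΘ′` FROM `Pi`-LANGUAGE LETTERS** — for a fine weight `r ≥ 0` with `Σ_{b′} r(b′)hk′(b′, y) ≤ Θ′` (every block `y`), on `‖A′‖ < a_C`:
`Σ_{b′} r(b′)‖(N((HD)′(A′)δ_bX))(b′)‖ ≤ 2Θ′Gℓ·‖A′‖·‖X‖` for `HD = Emap (H₀ ∘L bridge) C εC`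
(✓`B11Eq88KernelColumnsComposite.colSum_weighted_comp_fderiv_Emap_le` at `(H₀, bridge ∘ C)` + §1–§2). [cite: Balaban1985Variational, (70)–(73) pp.288–289, (86)–(88) p.291] -/
theorem thetaPrime_row (bb : Bond d Pd) {r : γ → ℝ} (hr : ∀ b', 0 ≤ r b') {Θ' : ℝ} (hΘ'0 : 0 ≤ Θ')
    (hΘ' : ∀ y, ∑ b', r b' * hk' b' y ≤ Θ') {A' : Space115 L η lev₀ lev₁ Dc} (hA' : ‖A'‖ < aC) (X : 𝔸) :
    ∑ b', r b' * ‖NegSup.equiv w' 𝔸 (N (fderiv ℂ (Emap (H₀.comp (piIsoNegSize0 𝔸 L η levB).toLinearIsometry.toContinuousLinearMap) C εC) A'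
        (single115 (lev₁ := lev₁) (Dc := Dc) bb X))) b'‖
      ≤ 2 * Θ' * G * (1 / (1 - 4 * b * C₂ * (εC + aC))) * ‖A'‖ * ‖X‖ := by
  rw [Emap_comp_piIso]
  exact colSum_weighted_comp_fderiv_Emap_le (regime_comp_piIso levB RC) (prop4Hyp_comp_piIso levB hC) hk0 (hHk_carrier levB hHk) hH1 hgC0
    (hCg_carrier levB hCg) hG hq N hk'0 (hNk_carrier levB N hNk) hΘH bb hr hΘ'0 hΘ' hA' X

variable [CompleteSpace 𝔸]

include RC hC hk0 hHk hΘH hH1 hΘHw hHw hgC0 hCg hG hq in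
/-- ★★★ **ROW `hΘ3` FROM `Pi`-LANGUAGE LETTERS** — on `‖A′‖ < a_C` (`0 < a_C`), `Σ_{b′}(w₃(b)∕w₃(b′))‖k_{(HD₃)′(A′)}(b′, b)‖ ≤ ((2ℓ + 1)Θ_H^wG∕a_C)·‖A′‖²` for
`HD₃ = E3 (H₀ ∘L bridge) C εC` (✓`B11Rem289KernelColumnsTheta3.colSum_weighted_kernel_fderiv_E3_le` at `(H₀, bridge ∘ C)` + §1–§2).
[cite: Balaban1985Variational, p.289 (after Prop. 3), (73) p.289, (86) p.291] -/
theorem theta3_row (haC : 0 < aC) {A' : Space115 L η lev₀ lev₁ Dc} (hA' : ‖A'‖ < aC) (bb : Bond d Pd) :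
    ∑ b', levWeight L η lev₀ 3 bb / levWeight L η lev₀ 3 b' *
        ‖kernel (fderiv ℂ (E3 (H₀.comp (piIsoNegSize0 𝔸 L η levB).toLinearIsometry.toContinuousLinearMap) C εC) A') b' bb‖
      ≤ ((2 * (1 / (1 - 4 * b * C₂ * (εC + aC))) + 1) * ΘHw * G / aC) * ‖A'‖ ^ 2 := by
  rw [E3_comp_piIso]
  exact colSum_weighted_kernel_fderiv_E3_le (regime_comp_piIso levB RC) (prop4Hyp_comp_piIso levB hC) haC hk0 (hHk_carrier levB hHk) hΘH hH1 hΘHw hHw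
    hgC0 (hCg_carrier levB hCg) hG hq hA' bb

end Rows

end Summit.QuantumFields.YangMills.Theorems.Prop7ThetaOfColumnLettersPi

end
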